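import Mathlib.Data.ZMod.Basic
import Mathlib.Data.Nat.Prime.Infinite
import Mathlib.Algebra.Group.TypeTags.Finite
import Literature.Algebra.Homology.TwoCocycleExtension
import Literature.Topology.FourManifolds.SurfaceGroupGenusOne
import Literature.Topology.FourManifolds.ProfiniteDetectionSumS1S2
import HarnessLib

/-!
# Surface groups do not solve every finite embedding problem (the Heisenberg obstruction), and
# are told apart from free groups by their finite quotients

Topic `Literature/Topology/FourManifolds`; companion of `AsphericalThreeManifoldGroupNotProjectiveProofs.lean`
(the commuting-pair / dihedral obstruction for `ℤ²`, and the reduction of the named fact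
`not_lift_fundamentalGroup_of_aspherical` to `H³(π̂₁; ℤ/2) ≠ 0`) and of
`ProfiniteDetectionSumS1S2.lean` (a group with the finite quotients of `F_k` solves every finite
embedding problem).  That proofs file lists under "NOT here" *the surface-relator analogue
(`π₁Σ_g → (ℤ/p)^{2g}` does not lift to the extraspecial extension when `p ∤ g`)*; it is PROVED here.
Everything is a theorem over the tree's `SurfaceGroup g = ⟨a₁, b₁, …, a_g, b_g ∣ ∏ᵢ [aᵢ, bᵢ]⟩`
(`GroupTrisections.lean`) and the cocycle extensions `E_f` of `TwoCocycleExtension.lean`; no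
definition, no named fact (D-0026).

## The argument (finite shadow of "`cd Ŝ_g = 2`, so `Ŝ_g` is not projective")

Serre, *Cohomologie galoisienne*, I §3.4 Prop. 16 with I §5.9 Cor. 2: a profinite group solves every
finite embedding problem iff it is projective iff `cd ≤ 1`; the profinite completion of the surface
group `S_g` (`g ≥ 1`) has `H²(Ŝ_g; 𝔽_p) ⊇ H²(S_g; 𝔽_p) = 𝔽_p ≠ 0` (surface groups are good), so it
is not projective.  At the finite level, with no cohomology: let `p` be a prime NOT dividing `g`,
`V = 𝔽_p^{2g}` with basis `e_{aᵢ}, e_{bᵢ}` (here `V = surfaceGen g → ZMod p`), and let `E` be the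
central extension of `V` by `𝔽_p` defined by the bilinear 2-cocycle
`B(v, w) = ∑ᵢ v(aᵢ) w(bᵢ)` (a Heisenberg / extraspecial-type group of order `p^{2g+1}`;
`E = E_B` of `TwoCocycleExtension.lean`).  In `E` the commutator of two elements over `v, w ∈ V` is
the central element `ι(B(v, w) - B(w, v))` (`commutator_eq_inl_of_trivial`), so for ANY lift
`F : S_g → E` of the abelianisation-mod-`p` map `S_g → V`, `aᵢ ↦ e_{aᵢ}`, `bᵢ ↦ e_{bᵢ}`, one has
`[F aᵢ, F bᵢ] = ι(1)` and hence `F(∏ᵢ [aᵢ, bᵢ]) = ι(g)`.  But `∏ᵢ [aᵢ, bᵢ] = 1` in `S_g`, so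
`g = 0` in `𝔽_p`, i.e. `p ∣ g` — a contradiction.  Hence `S_g ↠ V` does not lift through `E ↠ V`
(`SurfaceGroup.not_forall_lift`), and — since a group with the finite quotients of a free group
solves every finite embedding problem (`exists_monoidHom_comp_eq_of_sameFiniteQuotients_freeGroup`)
— `S_g` (`g ≥ 1`) does not have the finite quotients of any free group `F_k`
(`SurfaceGroup.not_sameFiniteQuotients_freeGroup`; finite shadow of `Ŝ_g ≇ F̂_k`).  For `g = 1`,
`S_1 = ℤ²`, this is the dihedral obstruction of the proofs file again (there with `p = 2`, `D₄`).

## References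

* J-P. Serre, *Cohomologie galoisienne* (LNM 5) = *Galois Cohomology* (1997), I §3.4 Prop. 16
  (lifting property ⟺ `cd ≤ 1`), I §5.9 Cor. 2 (projective ⟺ `cd ≤ 1`), I §2.6 Ex. 2 (good groups).
  [Serre1997]
* K. S. Brown, *Cohomology of Groups*, GTM 87 (1982), IV §3 (the extension `E_f` of a 2-cocycle).
  [Brown1982CohomologyGroups]
* A. Hatcher, *Algebraic Topology* (2002), §1.2 p. 51 (`π₁(Σ_g) = ⟨a₁, b₁, …, a_g, b_g ∣ ∏[aᵢ, bᵢ]⟩`).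
  [HatcherAT2002]
-/

noncomputable section

namespace Literature.Topology.FourManifolds

open Function Multiplicative groupCohomology
open Literature.Algebra.Homology

universe u

/-! ### Bilinear 2-cocycles and commutators in the extension group -/

/-- A biadditive map `B : V × V → k` on an abelian group `V` is a 2-cocycle of the group `V`
(written multiplicatively) with values in the trivial module `k`: the cocycle identity
`B(u + v, w) + B(u, v) = B(v, w) + B(u, v + w)` is biadditivity. [cite: Brown1982CohomologyGroups, IV §3 (3.3)] -/
theorem exists_cocycles₂_of_biadditive {k : Type u} [CommRing k] {V : Type u} [AddCommGroup V]
    (B : V →+ V →+ k) :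
    ∃ f : cocycles₂ (Rep.trivial k (Multiplicative V) k),
      ∀ v w : Multiplicative V, f (v, w) = B v.toAdd w.toAdd := by
  refine ⟨⟨fun q => B q.1.toAdd q.2.toAdd, (mem_cocycles₂_iff _).2 fun x y z => ?_⟩, fun v w => rfl⟩
  simp only [toAdd_mul, map_add, AddMonoidHom.add_apply, Representation.trivial_apply]
  abel

/-- **Commutators in a central extension defined by a 2-cocycle.**  In the extension group `E_f` of
a group `G` by a TRIVIAL module, defined by the 2-cocycle `f` (`TwoCocycleExtension.lean`), two
elements `x, y` whose images `u, v` in `G` commute have commutator the central element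
`ι(f(u, v) - f(v, u))`. [cite: Brown1982CohomologyGroups, IV §3 (3.3)–(3.5)] -/
theorem CocycleExtension.commutator_eq_inl_of_trivial {k : Type u} [CommRing k] {G : Type u}
    [Group G] {V : Type u} [AddCommGroup V] [Module k V] (f : cocycles₂ (Rep.trivial k G V))
    (x y : CocycleExtension f) (hxy : Commute x.right y.right) :
    x * y * x⁻¹ * y⁻¹ =
      CocycleExtension.inl f (ofAdd (f (x.right, y.right) - f (y.right, x.right))) := by
  -- `x y = ι(f(u,v) - f(v,u)) · (y x)`
  have h : x * y =
      CocycleExtension.inl f (ofAdd (f (x.right, y.right) - f (y.right, x.right))) * (y * x) := by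
    ext
    · simp only [CocycleExtension.mul_left, CocycleExtension.mul_right]
      rw [CocycleExtension.inl_left, CocycleExtension.inl_right, toAdd_ofAdd,
        cocycles₂_map_one_fst f (y.right * x.right)]
      simp only [Representation.trivial_apply]
      abel
    · simp only [CocycleExtension.mul_right]
      rw [CocycleExtension.inl_right, one_mul, hxy.eq]
  rw [h]
  group

/-! ### The surface relator as a product of commutators -/

variable {g : ℕ}

/-- In `S_g` the product of commutators `∏ᵢ [aᵢ, bᵢ]` (in increasing order of `i`) is trivial —
the defining relation. [cite: HatcherAT2002, §1.2 p. 51] -/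
theorem SurfaceGroup.prod_commutator_eq_one (g : ℕ) :
    ((List.finRange g).map fun i =>
        SurfaceGroup.a i * SurfaceGroup.b i * (SurfaceGroup.a i)⁻¹ * (SurfaceGroup.b i)⁻¹).prod =
      (1 : SurfaceGroup g) := by
  -- the defining relation, with the relator unfolded to its product form
  have h : PresentedGroup.mk ({surfaceRelator g} : Set (FreeGroup (surfaceGen g)))
      (((List.finRange g).map fun i => genA i * genB i * (genA i)⁻¹ * (genB i)⁻¹).prod) =
      (1 : SurfaceGroup g) :=
    SurfaceGroup.mk_surfaceRelator
  rw [map_list_prod, List.map_map] at h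
  refine Eq.trans ?_ h
  congr 1

/-! ### Surface groups do not solve every finite embedding problem -/

/-- **The Heisenberg obstruction: surface groups do not solve every finite embedding problem.**
For `g ≥ 1` the surface group `S_g = ⟨a₁, b₁, …, a_g, b_g ∣ ∏ᵢ [aᵢ, bᵢ]⟩` admits a homomorphism
`π : S_g → P` to a finite group and a surjection of finite groups `ε : E ↠ P` through which `π`
does not lift.  Witness: `p` a prime not dividing `g`, `P = V = 𝔽_p^{2g}`, `π` the abelianisation
mod `p` (`aᵢ ↦ e_{aᵢ}`, `bᵢ ↦ e_{bᵢ}`), `E ↠ V` the central extension by `𝔽_p` with cocycle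
`B(v, w) = ∑ᵢ v(aᵢ) w(bᵢ)` (order `p^{2g+1}`): any lift `F` has `[F aᵢ, F bᵢ] = ι(1)`
(`CocycleExtension.commutator_eq_inl_of_trivial`), so `1 = F(∏ᵢ [aᵢ, bᵢ]) = ι(g)` forces `p ∣ g`.
(Finite shadow of: `Ŝ_g` is not a projective profinite group, `cd Ŝ_g = 2` — Serre, *Cohomologie
galoisienne*, I §3.4 Prop. 16 with I §5.9 Cor. 2.)
[cite: Serre1997, I §3.4 Prop. 16 and I §5.9 Cor. 2] -/
theorem SurfaceGroup.not_forall_lift (hg : 1 ≤ g) :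
    ¬ ∀ (P E : Type) [Group P] [Finite P] [Group E] [Finite E] (π : SurfaceGroup g →* P)
        (ε : E →* P), Function.Surjective ε → ∃ F : SurfaceGroup g →* E, ε.comp F = π := by
  intro H
  -- a prime `p` not dividing `g`
  obtain ⟨p, hgp, hp⟩ := Nat.exists_infinite_primes (g + 1)
  haveI : NeZero p := ⟨hp.ne_zero⟩
  have hpg : ¬ p ∣ g := fun hd => by
    have := Nat.le_of_dvd (by omega) hd
    omega
  -- `V = 𝔽_p^{2g}` and the bilinear cocycle `B(v, w) = ∑ᵢ v(aᵢ) w(bᵢ)`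
  let B : (surfaceGen g → ZMod p) →+ (surfaceGen g → ZMod p) →+ ZMod p :=
    { toFun := fun v =>
        { toFun := fun w => ∑ i : Fin g, v (i, false) * w (i, true)
          map_zero' := by simp
          map_add' := fun w w' => by
            simp only [Pi.add_apply, mul_add, Finset.sum_add_distrib] }
      map_zero' := AddMonoidHom.ext fun w => by simp
      map_add' := fun v v' => AddMonoidHom.ext fun w => by
        simp only [AddMonoidHom.coe_mk, ZeroHom.coe_mk, AddMonoidHom.add_apply, Pi.add_apply,
          add_mul, Finset.sum_add_distrib] }
  have hB : ∀ i : Fin g, B (Pi.single (i, false) 1) (Pi.single (i, true) 1) = 1 ∧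
      B (Pi.single (i, true) 1) (Pi.single (i, false) 1) = 0 := fun i => by
    constructor
    · simp only [B, AddMonoidHom.coe_mk, ZeroHom.coe_mk]
      rw [Finset.sum_eq_single i]
      · simp
      · intro j _ hj
        simp [hj]
      · simp
    · simp [B]
  obtain ⟨f, hf⟩ := exists_cocycles₂_of_biadditive B
  -- the extension group `E = E_f ↠ V` is a finite embedding problem for `π : S_g → V`
  haveI : Finite (Rep.trivial (ZMod p) (Multiplicative (surfaceGen g → ZMod p)) (ZMod p)) :=
    inferInstanceAs (Finite (ZMod p))
  let π : SurfaceGroup g →* Multiplicative (surfaceGen g → ZMod p) :=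
    SurfaceGroup.toCommGroup fun x => ofAdd (Pi.single x 1)
  obtain ⟨F, hF⟩ := H (Multiplicative (surfaceGen g → ZMod p)) (CocycleExtension f) π
    (CocycleExtension.rightHom f) (CocycleExtension.rightHom_surjective f)
  have hFr : ∀ s, (F s).right = π s := fun s => by
    rw [← hF]
    rfl
  -- each commutator `[F aᵢ, F bᵢ]` is the central element `ι(1)`
  have hcomm : ∀ i : Fin g,
      F (SurfaceGroup.a i) * F (SurfaceGroup.b i) * (F (SurfaceGroup.a i))⁻¹ *
          (F (SurfaceGroup.b i))⁻¹ = CocycleExtension.inl f (ofAdd 1) := fun i => by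
    rw [CocycleExtension.commutator_eq_inl_of_trivial f _ _ (Commute.all _ _), hFr, hFr, hf, hf]
    simp only [π, SurfaceGroup.toCommGroup_a, SurfaceGroup.toCommGroup_b, toAdd_ofAdd,
      (hB i).1, (hB i).2, sub_zero]
  -- so `F (∏ᵢ [aᵢ, bᵢ]) = ι(1)^g = ι(g)` is trivial
  have hprod := congrArg F (SurfaceGroup.prod_commutator_eq_one g)
  rw [map_list_prod, List.map_map, map_one] at hprod
  have hrepl : ((List.finRange g).map fun _ : Fin g =>
      CocycleExtension.inl f (ofAdd (1 : ZMod p))).prod = 1 := by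
    rw [← hprod]
    congr 1
    refine List.map_congr_left fun i _ => ?_
    rw [Function.comp_apply, map_mul, map_mul, map_mul, map_inv, map_inv, hcomm]
  rw [List.map_const', List.length_finRange, List.prod_replicate, ← map_pow, ← ofAdd_nsmul,
    nsmul_eq_mul, mul_one] at hrepl
  -- hence `g = 0` in `𝔽_p`, i.e. `p ∣ g`
  have h0 : ((g : ℕ) : ZMod p) = 0 := by
    have h1 := CocycleExtension.inl_injective f (hrepl.trans (map_one _).symm)
    rwa [ofAdd_eq_one] at h1
  exact hpg ((ZMod.natCast_eq_zero_iff g p).1 h0)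

/-- **Surface groups are told apart from free groups by their finite quotients** (finite shadow of
`Ŝ_g ≇ F̂_k`: `cd Ŝ_g = 2` while free profinite groups are projective).  For `g ≥ 1` and any `k`,
it is not the case that `S_g` and `F_k` have the same finite quotients: a group with the finite
quotients of `F_k` solves every finite embedding problem
(`exists_monoidHom_comp_eq_of_sameFiniteQuotients_freeGroup`), and `S_g` does not
(`SurfaceGroup.not_forall_lift`). [cite: Serre1997, I §3.4 Prop. 16 and I §5.9 Cor. 2] -/
theorem SurfaceGroup.not_sameFiniteQuotients_freeGroup (hg : 1 ≤ g) (k : ℕ) :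
    ¬ ∀ (Q : Type) [Group Q] [Finite Q],
        (∃ f : SurfaceGroup g →* Q, Function.Surjective f) ↔
          (∃ f : FreeGroup (Fin k) →* Q, Function.Surjective f) :=
  fun hQ => SurfaceGroup.not_forall_lift hg fun _ _ _ _ _ _ π ε hε =>
    exists_monoidHom_comp_eq_of_sameFiniteQuotients_freeGroup hQ π ε hε

end Literature.Topology.FourManifolds

end
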